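import Summits.BirchSwinnertonDyer.Rank1Residual.X11b.Three.ClassRecordAtThree
import Summits.BirchSwinnertonDyer.Rank1Residual.Iwasawa.UnitCoefficientCertificateMultiplicative
import HarnessLib

/-!
# X11b @ `p = 3`, UNITCOEFF@3 JOIN (ROUTE-2 §16 (b)): road (a) at ONE pair — non-split multiplicative
# at `3`, (ram) — from the unit-coefficient certificate `Iwasawa.UnitCoeffAt W 3 1`
# (CONSUMER-ONLY, CONDITIONAL; theorems only)

HONEST FRAMING (cell `b2b-bsdres`, run/shared/lean/b2b/bsd-rank1-residual/, verbatim in every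
file): the goal of the cell is to DELETE the COMBINATION-SHAPED residual classes of the
Birch–Swinnerton-Dyer formula for ALL analytic-rank `≤ 1` elliptic curves over `ℚ` — "full BSD
formula for every rank `≤ 1` curve in class `C`" assembled STRICTLY from published theorems — so
that the rank-`≤ 1` remainder becomes exactly the CONSTRUCTION-SHAPED classes, which are TYPED
(missing-input `Prop`s), NOT attempted. This is not "finishing BSD". Team `x11b3` = N8/O2 (X11b at
`p = 3`: `3 ‖ N`, `r_an = 1`, `E[3]` irreducible): RESEARCH ROUTES; published theorems only; the
construction-shaped remainder is TYPED, not attempted; census output = EVIDENCE, never a Literature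
fact; nothing booked; no label change; O2 stays OPEN; no route opened.

PROVENANCE (team `cells/x11b3/`, LEAD DEAL #7 R7-42 (B)(i), ROUTE-2.md §16 (b)/(b′)): statements AND
proofs of this file are route planner 2's kernel-checked sketch
`HOME/b2b-bsdres-x11b3-r2/gen6/UnitCoeffJoinSketch.lean` (sha16 d774406fe047bad9, `lean check` rc 0),
ported VERBATIM and filed by seat `b2b-bsdres-x11b3-p3` (gen. 4); one packaging corollary added (§2).

## What is kernel-checked here (THEOREMS only; no definition, no fact, no hypothesis shape)

Road (a) of the X11b@3 class record (`X11b/Three/ClassRecordAtThree.lean`: non-split multiplicative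
at `3` ∧ (ram), the 722 true-open class-pairs of the census) needs ONE per-pair input,
`RegulatorNonvanishingAt W 3` = Schneider's non-degeneracy of THE canonical §4.2 `3`-adic height
(`bsdp_of_ram_of_nonsplit_of_regulatorNonvanishing`, `regulatorNonvanishingAt_iff_of_nonsplit`). The
instrument unit `b2b-bsdres-iw-1` (IWASAWA-INVARIANT CENSUS) supplies, per pair and with two engines,
the ANALYTIC-side certificate `Iwasawa.UnitCoeffAt W 3 1` ("minimal pair": `μ_an = 0`, `λ_an = 1`: the
coefficient of `T¹` in the Néron-normalised `ϖ·L₃(E, T)` is a `3`-adic unit and the constant one is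
not), and `Iwasawa/UnitCoefficientCertificateMultiplicative.lean` §3 turns it — through Kato's
divisibility under `3^n`-surjectivity (Wuthrich 2014, Cor. 19 with Lemma 20: `9 ∤ N` and `ρ̄_{E,3}`
onto ⇒ every `ρ̄_{E,3^n}` onto) and Stein–Wuthrich Thm. 6.1 clause 2 (non-split) — into Schneider's
conjecture for THE canonical height ∧ `Ш(E/ℚ)[3^∞]` finite
(`Iwasawa.schneider_and_finite_sha_of_unitCoeffAt_nonsplit`). This file is the JOIN:

* §1 **`Three.bsdp_of_ram_of_nonsplit_of_unitCoeffAt`**: on an X11b pair `(E, 3)` NON-SPLIT at `3` with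
  a (ram) prime, `Iwasawa.UnitCoeffAt W 3 1 ⟹ BSDp W 3`, CONDITIONAL on the eight named facts it
  binds (road (a)'s six: Skinner 2016 Thm. A multiplicative, SW13 Thm. 6.1 non-split, the canonical
  §4.2 height datum, Disegni 2020 Thm. 1, Gross–Zagier–Kolyvagin, modular parametrisation; plus Kato's
  integral divisibility under surjectivity `Wuthrich2014.kato_charIdeal_dvd_multiplicative_of_surjective`
  and `Wuthrich2014.lemma20_surjective_threeAdic_of_semistable`); `Surj W 3` is FORCED on X11b by
  (ram) (`not_ram_of_classX11b_of_not_surj`), rank `= 1` by GZK;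
  **`Three.mazurMC_and_finite_sha_of_unitCoeffAt`**: by-products on a certified row — Mazur's main
  conjecture at `(E, 3)` and `Ш(E/ℚ)[3^∞]` finite;
* §2 `Three.bsdp_and_mazurMC_and_finite_sha_of_unitCoeffAt`: the three conclusions packaged.

## What this does NOT do
It certifies NO pair (the certificate `UnitCoeffAt W 3 1` is a HYPOTHESIS, supplied per pair by the
instrument as EVIDENCE; the UNITCOEFF@3 pilot of R7-42 (C) is a pre-registered prediction exercise,
job-gated); it discharges none of the named facts (flags for referee A's list); nothing is booked; no
mark / label / count moves; cells stay TRUE-OPEN; O2 stays OPEN.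

References: [Wuthrich2014] Cor. 19, Lemma 20 (p. 399); [SteinWuthrich2013] Thm. 6.1 (p. 20), §11
(p. 29); [Skinner2016] Thm. A; [Disegni2020] Thm. 1; [GreenbergVatsal2000] p. 4; ROUTE-2.md §16
(x11b3-r2 gen. 6, f99f94435d91130c); HOME/IWASAWA-CENSUS.md §4.4 (1).
-/

noncomputable section

open scoped Classical MatrixGroups ModularForm

open CongruenceSubgroup WeierstrassCurve NumberField IsDedekindDomain Field
  Literature.NumberTheory.EllipticCurves
  Rat.HeightOneSpectrum
  Literature.NumberTheory.DiophantineGeometry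
  Literature.NumberTheory.EllipticCurves.GreenbergSelmer
  Literature.NumberTheory.EllipticCurves.ModularForms
  Literature.NumberTheory.EllipticCurves.Rank1Residual
  Literature.NumberTheory.EllipticCurves.Rank1Residual.Typed
  Literature.NumberTheory.EllipticCurves.Wuthrich2014
  Literature.NumberTheory.EllipticCurves.GreenbergVatsal2000
  Literature.NumberTheory.EllipticCurves.BalakrishnanEtAl2019
  Literature.NumberTheory.EllipticCurves.Skinner2016
  Literature.NumberTheory.EllipticCurves.SteinWuthrich2013
  Literature.NumberTheory.EllipticCurves.Disegni2020
  Literature.NumberTheory.EllipticCurves.BarriosEtAl2025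
  Literature.NumberTheory.QuadraticFields.Quadratic
  Literature.NumberTheory.Automorphic
  Literature.NumberTheory.GaloisRepresentations Literature.NumberTheory.GaloisCohomology
  Summit.BirchSwinnertonDyer.Rank1Residual.X11b.AcSelmer
  Summit.BirchSwinnertonDyer.Rank1Residual.X11b.LocBridge

set_option autoImplicit false

namespace Summit.BirchSwinnertonDyer.Rank1Residual.X11b.Three

/-! ## §1 The JOIN (route planner 2's sketch, verbatim) -/

/-- **ROAD (a) AT ONE PAIR from the unit-coefficient certificate** (X11b, NON-SPLIT multiplicative at
`3`, (ram)): `UnitCoeffAt W 3 1` ⇒ (Kato + Lemma 20 + SW Thm. 6.1 non-split) Schneider for THE §4.2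
datum ⇒ `RegulatorNonvanishingAt W 3` ⇒ (road (a) of the class record) `BSDp W 3`. CONDITIONAL on the
eight named facts bound as hypotheses; `Surj W 3` is forced by (ram) on X11b, `rank E(ℚ) = 1` by GZK.
[cite: Wuthrich2014, Cor. 19 and Lemma 20 (p. 399)] [cite: SteinWuthrich2013, Thm. 6.1 (p. 20)] -/
theorem bsdp_of_ram_of_nonsplit_of_unitCoeffAt (hSkA : thmA_charIdeal_multiplicative)
    (hJn : thm61_nonsplitMultiplicative) (hHn : exists_isMultCanonical)
    (hD : thm1_padicBSD_rankOne_multiplicative)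
    (hGZK : rank_eq_analyticRank_of_analyticRank_le_one) (hpar : nonempty_modularParametrizationData)
    (hKato : kato_charIdeal_dvd_multiplicative_of_surjective)
    (h20 : lemma20_surjective_threeAdic_of_semistable)
    (W : WeierstrassCurve ℚ) [W.IsElliptic] [W.IsGloballyMinimal] [Fact (Nat.Prime 3)]
    (hX : ClassX11b W 3) (hram : Ram W 3) (hns : ¬ W.HasSplitMultiplicativeReductionAtPrime 3)
    (hcert : Iwasawa.UnitCoeffAt W 3 1) : BSDp W 3 := by
  refine bsdp_of_ram_of_nonsplit_of_regulatorNonvanishing hSkA hJn hHn hD hGZK hpar W 3 hX hram hns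
    ((regulatorNonvanishingAt_iff_of_nonsplit W 3 hns).2 ?_)
  intro q Dh hq0 hq1 hqj hDh
  have hsurj : Surj W 3 := by
    by_contra h
    exact not_ram_of_classX11b_of_not_surj W hX h hram
  obtain ⟨hr, hp2, hmult, hirr⟩ := hX
  have hsurj' : ∀ n : ℕ, W.HasSurjectiveModNGaloisRep (3 ^ n : ℕ) := h20 W (Or.inr hmult) hsurj
  have hrk : W.mordellWeilRank = 1 := by
    have h := (hGZK W (le_of_eq hr)).1
    omega
  have hcert' : Iwasawa.UnitCoeffAt W 3 W.mordellWeilRank := by rw [hrk]; exact hcert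
  obtain ⟨κ, hκ, γ, hγ, hγ'⟩ := exists_isCyclotomic_isTopGenerator_isCyclotomicVariable_holds 3
  obtain ⟨D⟩ := W.nonempty_selmerDualData_holds κ γ hγ
  haveI : NeZero (W.conductorNorm ℤ) := ⟨(W.conductorNorm_pos_holds).ne'⟩
  obtain ⟨Dm⟩ := hpar W
  obtain ⟨ϖ, hϖpos, hϖ, -⟩ := Dm.exists_rat_mul_realPeriodRat_eq_plusPeriod
  obtain ⟨L, hL⟩ := exists_isMultPAdicLFunctionOf_neg_one_of_nonsplit Dm.isNewformOf hmult hns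
  exact (Iwasawa.schneider_and_finite_sha_of_unitCoeffAt_nonsplit W 3 hKato hJn hp2 hmult hns hsurj'
    hcert' q hq0 hq1 hqj hκ hγ hγ' _ Dm.isNewformOf D ϖ hϖ L hL Dh hDh).1

/-- **By-products on a certified row**: Mazur's main conjecture at `(E, 3)` and `Ш(E/ℚ)[3^∞]` finite,
from `UnitCoeffAt W 3 1` on an X11b pair non-split at `3` with a (ram) prime (Kato + Lemma 20; SW Thm.
6.1 non-split for the finiteness, with THE canonical height datum `hHn`). CONDITIONAL on the named
facts bound as hypotheses. [cite: Wuthrich2014, Cor. 19 and Lemma 20 (p. 399)]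
[cite: SteinWuthrich2013, Thm. 6.1 (p. 20)] -/
theorem mazurMC_and_finite_sha_of_unitCoeffAt (hJn : thm61_nonsplitMultiplicative)
    (hHn : exists_isMultCanonical) (hGZK : rank_eq_analyticRank_of_analyticRank_le_one)
    (hpar : nonempty_modularParametrizationData)
    (hKato : kato_charIdeal_dvd_multiplicative_of_surjective)
    (h20 : lemma20_surjective_threeAdic_of_semistable)
    (W : WeierstrassCurve ℚ) [W.IsElliptic] [W.IsGloballyMinimal] [Fact (Nat.Prime 3)]
    (hX : ClassX11b W 3) (hram : Ram W 3) (hns : ¬ W.HasSplitMultiplicativeReductionAtPrime 3)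
    (hcert : Iwasawa.UnitCoeffAt W 3 1) :
    X2.MazurMainConjectureAt W 3 ∧ Finite (AddCommGroup.primaryComponent W.sha 3) := by
  have hsurj : Surj W 3 := by
    by_contra h
    exact not_ram_of_classX11b_of_not_surj W hX h hram
  obtain ⟨hr, hp2, hmult, hirr⟩ := hX
  have hsurj' : ∀ n : ℕ, W.HasSurjectiveModNGaloisRep (3 ^ n : ℕ) := h20 W (Or.inr hmult) hsurj
  have hrk : W.mordellWeilRank = 1 := by
    have h := (hGZK W (le_of_eq hr)).1
    omega
  have hcert' : Iwasawa.UnitCoeffAt W 3 W.mordellWeilRank := by rw [hrk]; exact hcert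
  refine ⟨Iwasawa.mazurMainConjectureAt_three_of_unitCoeffAt_mordellWeilRank hKato h20 W hmult hsurj
    hcert', ?_⟩
  obtain ⟨κ, hκ, γ, hγ, hγ'⟩ := exists_isCyclotomic_isTopGenerator_isCyclotomicVariable_holds 3
  obtain ⟨D⟩ := W.nonempty_selmerDualData_holds κ γ hγ
  haveI : NeZero (W.conductorNorm ℤ) := ⟨(W.conductorNorm_pos_holds).ne'⟩
  obtain ⟨Dm⟩ := hpar W
  obtain ⟨ϖ, hϖpos, hϖ, -⟩ := Dm.exists_rat_mul_realPeriodRat_eq_plusPeriod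
  obtain ⟨L, hL⟩ := exists_isMultPAdicLFunctionOf_neg_one_of_nonsplit Dm.isNewformOf hmult hns
  obtain ⟨q, ⟨hq0, hq1, hqj⟩, -⟩ := existsUnique_tateJ_eq_of_one_lt_norm
    (one_lt_norm_j_of_hasMultiplicativeReductionAtPrime (W := W) (p := 3) hmult)
  obtain ⟨Dh, hDh⟩ := hHn W 3 hp2 hmult hns q hq0 hq1 hqj
  exact (Iwasawa.schneider_and_finite_sha_of_unitCoeffAt_nonsplit W 3 hKato hJn hp2 hmult hns hsurj'
    hcert' q hq0 hq1 hqj hκ hγ hγ' _ Dm.isNewformOf D ϖ hϖ L hL Dh hDh).2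

/-! ## §2 Packaging -/

/-- **On a certified X11b row non-split at `3` with a (ram) prime**: `BSD₃(E)` ∧ Mazur's main
conjecture at `(E, 3)` ∧ `Ш(E/ℚ)[3^∞]` finite — the three conclusions of §1 together, under the union
of their named-fact hypotheses. [cite: Wuthrich2014, Cor. 19 and Lemma 20 (p. 399)]
[cite: SteinWuthrich2013, Thm. 6.1 (p. 20)] -/
theorem bsdp_and_mazurMC_and_finite_sha_of_unitCoeffAt (hSkA : thmA_charIdeal_multiplicative)
    (hJn : thm61_nonsplitMultiplicative) (hHn : exists_isMultCanonical)
    (hD : thm1_padicBSD_rankOne_multiplicative)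
    (hGZK : rank_eq_analyticRank_of_analyticRank_le_one) (hpar : nonempty_modularParametrizationData)
    (hKato : kato_charIdeal_dvd_multiplicative_of_surjective)
    (h20 : lemma20_surjective_threeAdic_of_semistable)
    (W : WeierstrassCurve ℚ) [W.IsElliptic] [W.IsGloballyMinimal] [Fact (Nat.Prime 3)]
    (hX : ClassX11b W 3) (hram : Ram W 3) (hns : ¬ W.HasSplitMultiplicativeReductionAtPrime 3)
    (hcert : Iwasawa.UnitCoeffAt W 3 1) :
    BSDp W 3 ∧ X2.MazurMainConjectureAt W 3 ∧ Finite (AddCommGroup.primaryComponent W.sha 3) :=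
  ⟨bsdp_of_ram_of_nonsplit_of_unitCoeffAt hSkA hJn hHn hD hGZK hpar hKato h20 W hX hram hns hcert,
    mazurMC_and_finite_sha_of_unitCoeffAt hJn hHn hGZK hpar hKato h20 W hX hram hns hcert⟩

end Summit.BirchSwinnertonDyer.Rank1Residual.X11b.Three

end
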